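import Summits.ValiantsHypothesis.ValiantsHypothesis.Theorems.GrenetZeonDualUnipotentThreeHalvesLongMassCeilings

/-!
# `GrenetZeon.DualUnipotentThreeHalves` (stmt-ValiantsHypothesis-24318), MASS-CUT line `slow_core`, stub `stub_longMassSlowLawInv`
# ((c) `SlowCore.LongMassSlowLawInv`): RANK-ONE DIRECTIONS HAVE WINDOW DEGREE ≤ 1

A kernel row for the ONE research statement (c) of the registered skeleton `Cruxes/DualUnipotentThreeHalves/Lines/slow_core.lean`
(rev 4; by ✓ `LongMassIrreducibilityFree.inv_iff_all` irreducibility is free in (c), so rows may be stated for arbitrary nilpotent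
affine pencils).

MATHEMATICS.  Let `N : AffMat n m` be affine with `N ^ H = 0`, and let `v` be a direction whose linear coefficient matrix
`(linEntry N i j v)_{ij}` has rank `≤ 1`, i.e. is an outer product `u ⊗ w` (`vecMulVec u w`).  Along the line `x + s·v` the pull-back is
`A + s·V` with `A = N(x)` and `V = u wᵀ`, nilpotent as a polynomial matrix in `s`.  Then:

* §1 `pow_add_smul_eq` / `pow_add_smul_of_sandwich` — the binomial expansion to first order,
  `(P + s•Q)^q = P^q + s • Σ_{a<q} P^a Q P^{q−1−a} + (s·s) • E`, exact (no `E`) when `(s·s) • (Q P^c Q) = 0` for all `c`;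
* §2 `trace_linTerm` — the trace of the linear term is `q • tr(P^{q−1} Q)`;
* §3 `trace_pow_mul_eq_zero_of_nilpotent_line` — if `A.map C + X₀ • V.map C` is nilpotent over `ℂ[s]` (reduced ring), then every
  `tr((A + sV)^{a+1}) = 0`, and its `s¹`-coefficient gives `tr(A^a V) = 0` for ALL `a` (char 0);
* §4 `sandwich_eq_zero_of_trace` — for `V = u wᵀ`: `V A^a V = (wᵀ A^a u) • V = tr(A^a V) • V = 0`;
* §5 ★ `totalDegree_pow_map_lineSubst_le_one_of_rankOne` — hence `(A + sV)^p = A^p + s • Σ_a A^a V A^{p−1−a}` EXACTLY: every entry of every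
  power of `N(x + s v)` has `s`-degree `≤ 1`.  Corollaries: `ledger_one_of_rankOne` (a direction space all of whose members have rank-`≤ 1`
  linear part — e.g. the line `ℂ·δ_e` of a coordinate `e` whose coefficient matrix `[x_e]N` has rank `≤ 1`, `ledger_one_span_single`, or the
  directions moving one fixed ROW or one fixed COLUMN of the pencil, `ledger_one_of_row` / `ledger_one_of_col` — is a whole-pencil ledger of
  window ORDER 1 for every nilpotent affine pencil).

USE (enemy spec of (c), crit-7 V34 §2, in the currency of ✓ `InitialForm.LedgerTorus.not_relCert_of_count`): the per-coordinate census can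
only count, at order `k ≥ 1`, coordinates whose coefficient matrix has RANK ≥ 2; a (c)-violator family certified by the count instrument at price
`P` therefore carries `> P − n` coordinates of coefficient-rank `≥ 2` (each failing the order-1 window test needs a nonzero word with two
copies of its coefficient matrix, impossible in rank one by §3–§4).  Honest framing: a support lemma (`--supports stmt-ValiantsHypothesis-24318`);
NOT progress on (c) `LongMassSlowLawInv`, which with S3 `SlowPlane`, the crux 24318, the rung 8062 and `VP ≠ VNP` stays OPEN / NOT proved.
No sorry, no definitions, no named facts. [folklore: first-order expansion of a perturbed power; traces of nilpotent matrices vanish]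
-/

-- single-conjunct layout: Sub = Summit, duplicated namespace component intended (the name is mandated)
set_option linter.dupNamespace false
set_option autoImplicit false

noncomputable section

namespace Summit.ValiantsHypothesis.ValiantsHypothesis.Theorems.GrenetZeon.LongMassRankOne

open MvPolynomial Matrix
open scoped BigOperators
open Summit.ValiantsHypothesis.ValiantsHypothesis.Cruxes.TwoDimCoefficients.DimTwoCases (AffMat IsAffine)
open Summit.ValiantsHypothesis.ValiantsHypothesis.Theorems.GrenetZeon.RadicalSplit (lineSubst)
open Summit.ValiantsHypothesis.ValiantsHypothesis.Theorems.GrenetZeon.SlowCore (Ledger RelCert linEntry lineSubst_apply_of_le_one)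
open Summit.ValiantsHypothesis.ValiantsHypothesis.Theorems.GrenetZeon.Ceilings (pow_lineSubst_eq_zero)

/-! ## §1 First-order expansion of a perturbed power -/

section Expansion

variable {ι R : Type*} [Fintype ι] [DecidableEq ι] [CommRing R]

/-- The linear term of `(P + s•Q)^q`: `Σ_{a<q} P^a · Q · P^{q−1−a}`. [folklore] -/
theorem linTerm_succ (P Q : Matrix ι ι R) (q : ℕ) :
    (∑ a ∈ Finset.range (q + 1), P ^ a * Q * P ^ (q + 1 - 1 - a)) =
      (∑ a ∈ Finset.range q, P ^ a * Q * P ^ (q - 1 - a)) * P + P ^ q * Q := by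
  rw [Finset.sum_range_succ, Finset.sum_mul]
  congr 1
  · refine Finset.sum_congr rfl fun a ha => ?_
    rw [Finset.mem_range] at ha
    rw [Matrix.mul_assoc (P ^ a * Q) (P ^ (q - 1 - a)) P, ← pow_succ]
    congr 2
    omega
  · rw [show q + 1 - 1 - q = 0 by omega, pow_zero, Matrix.mul_one]

/-- **First-order expansion with remainder**: `(P + s•Q)^q = P^q + s • Σ_{a<q} P^a Q P^{q−1−a} + (s·s) • E` for some matrix `E`. [folklore] -/
theorem pow_add_smul_eq (P Q : Matrix ι ι R) (s : R) (q : ℕ) :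
    ∃ E : Matrix ι ι R,
      (P + s • Q) ^ q = P ^ q + s • (∑ a ∈ Finset.range q, P ^ a * Q * P ^ (q - 1 - a)) + (s * s) • E := by
  induction q with
  | zero => exact ⟨0, by simp⟩
  | succ q ih =>
    obtain ⟨E, hE⟩ := ih
    refine ⟨(∑ a ∈ Finset.range q, P ^ a * Q * P ^ (q - 1 - a)) * Q + E * P + s • (E * Q), ?_⟩
    rw [linTerm_succ, pow_succ, hE, pow_succ]
    simp only [add_mul, mul_add, smul_mul_assoc, mul_smul_comm, smul_add, smul_smul, mul_assoc]
    abel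

/-- **Exact first-order expansion** when the perturbation is SANDWICH-ANNIHILATED to second order:
`(s·s) • (Q P^c Q) = 0` for all `c` ⇒ `(P + s•Q)^q = P^q + s • Σ_{a<q} P^a Q P^{q−1−a}`. [folklore] -/
theorem pow_add_smul_of_sandwich (P Q : Matrix ι ι R) (s : R) (hQ : ∀ c : ℕ, (s * s) • (Q * P ^ c * Q) = 0) (q : ℕ) :
    (P + s • Q) ^ q = P ^ q + s • ∑ a ∈ Finset.range q, P ^ a * Q * P ^ (q - 1 - a) := by
  induction q with
  | zero => simp
  | succ q ih =>
    have hvan : (s * s) • ((∑ a ∈ Finset.range q, P ^ a * Q * P ^ (q - 1 - a)) * Q) = 0 := by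
      rw [Finset.sum_mul, Finset.smul_sum]
      refine Finset.sum_eq_zero fun a _ => ?_
      rw [Matrix.mul_assoc, Matrix.mul_assoc, ← mul_smul_comm, ← Matrix.mul_assoc Q, hQ, Matrix.mul_zero]
    rw [linTerm_succ, pow_succ, ih, pow_succ]
    simp only [add_mul, mul_add, smul_mul_assoc, mul_smul_comm, smul_add, smul_smul]
    rw [hvan, add_zero, add_assoc]

/-! ## §2 The trace of the linear term -/

/-- `tr(Σ_{a<q} P^a Q P^{q−1−a}) = q • tr(P^{q−1} Q)` (cyclicity). [folklore] -/
theorem trace_linTerm (P Q : Matrix ι ι R) (q : ℕ) :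
    Matrix.trace (∑ a ∈ Finset.range q, P ^ a * Q * P ^ (q - 1 - a)) = q • Matrix.trace (P ^ (q - 1) * Q) := by
  rw [Matrix.trace_sum]
  have h : ∀ a ∈ Finset.range q, Matrix.trace (P ^ a * Q * P ^ (q - 1 - a)) = Matrix.trace (P ^ (q - 1) * Q) := by
    intro a ha
    rw [Finset.mem_range] at ha
    rw [Matrix.trace_mul_comm, ← Matrix.mul_assoc, ← pow_add]
    congr 3
    omega
  rw [Finset.sum_congr rfl h, Finset.sum_const, Finset.card_range]

end Expansion

/-! ## §3 Nilpotent lines: `tr(A^a V) = 0` for every `a` -/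

section NilpotentLine

variable {ι : Type*} [Fintype ι] [DecidableEq ι]

/-- The `s¹`-coefficient of `C α + X₀ • C β + (X₀·X₀) • γ` is `β`. -/
theorem coeff_single_one_of_expansion (α β : ℂ) (γ : MvPolynomial (Fin 1) ℂ) :
    coeff (Finsupp.single 0 1) (C α + (X 0 : MvPolynomial (Fin 1) ℂ) • C β + ((X 0 : MvPolynomial (Fin 1) ℂ) * X 0) • γ) = β := by
  classical
  have h1 : coeff (Finsupp.single (0 : Fin 1) 1) (C α : MvPolynomial (Fin 1) ℂ) = 0 := by
    rw [coeff_C, if_neg]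
    intro h
    have := Finsupp.single_eq_zero.mp h.symm
    exact one_ne_zero this
  have h2 : coeff (Finsupp.single (0 : Fin 1) 1) ((X 0 : MvPolynomial (Fin 1) ℂ) * C β) = β := by
    rw [show Finsupp.single (0 : Fin 1) 1 = Finsupp.single (0 : Fin 1) 1 + 0 from (add_zero _).symm, coeff_X_mul, coeff_C,
      if_pos rfl]
  have h3 : coeff (Finsupp.single (0 : Fin 1) 1) ((X 0 : MvPolynomial (Fin 1) ℂ) * (X 0 * γ)) = 0 := by
    rw [coeff_X_mul', if_pos (by simp), coeff_X_mul', if_neg]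
    simp
  simp only [smul_eq_mul]
  rw [mul_assoc, coeff_add, coeff_add, h1, h2, h3, zero_add, add_zero]

/-- **On a nilpotent affine line all mixed traces `tr(A^a V)` vanish.**  If the polynomial matrix `A + s·V` (over `ℂ[s]`,
`s = X 0`) is nilpotent, then `tr(A^a · V) = 0` for every `a`: the `s¹`-coefficient of `tr((A + sV)^{a+1}) = 0` is `(a+1)·tr(A^a V)`.
[folklore] -/
theorem trace_pow_mul_eq_zero_of_nilpotent_line (A V : Matrix ι ι ℂ) {H : ℕ}
    (hnil : (A.map (C : ℂ → MvPolynomial (Fin 1) ℂ) + (X 0 : MvPolynomial (Fin 1) ℂ) • V.map C) ^ H = 0) (a : ℕ) :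
    Matrix.trace (A ^ a * V) = 0 := by
  set P : Matrix ι ι (MvPolynomial (Fin 1) ℂ) := A.map C with hP
  set Q : Matrix ι ι (MvPolynomial (Fin 1) ℂ) := V.map C with hQ
  set s : MvPolynomial (Fin 1) ℂ := X 0 with hs
  have hM : IsNilpotent (P + s • Q) := ⟨H, hnil⟩
  have htr : Matrix.trace ((P + s • Q) ^ (a + 1)) = 0 :=
    (Matrix.isNilpotent_trace_of_isNilpotent (hM.pow_succ a)).eq_zero
  obtain ⟨E, hE⟩ := pow_add_smul_eq P Q s (a + 1)
  rw [hE, Matrix.trace_add, Matrix.trace_add, Matrix.trace_smul, Matrix.trace_smul, trace_linTerm,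
    show a + 1 - 1 = a from rfl] at htr
  have hPa : P ^ a * Q = (A ^ a * V).map (C : ℂ → MvPolynomial (Fin 1) ℂ) := by
    rw [hP, hQ, Matrix.map_mul, Matrix.map_pow A (C : ℂ →+* MvPolynomial (Fin 1) ℂ)]
  have hPa1 : P ^ (a + 1) = (A ^ (a + 1)).map (C : ℂ → MvPolynomial (Fin 1) ℂ) := by
    rw [hP, Matrix.map_pow A (C : ℂ →+* MvPolynomial (Fin 1) ℂ)]
  rw [hPa, hPa1, ← AddMonoidHom.map_trace C, ← AddMonoidHom.map_trace C, ← map_nsmul] at htr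
  have hcoeff := congrArg (coeff (Finsupp.single (0 : Fin 1) 1)) htr
  rw [coeff_single_one_of_expansion, coeff_zero] at hcoeff
  exact (smul_eq_zero.mp hcoeff).resolve_left (Nat.succ_ne_zero a)

end NilpotentLine

/-! ## §4 Rank one: vanishing traces annihilate sandwiches -/

section RankOne

variable {ι : Type*} [Fintype ι]

/-- `V A V = tr(A V) • V` for a rank-one `V = u wᵀ`; hence `tr(A·V) = 0 ⇒ V·A·V = 0`. [folklore] -/
theorem sandwich_eq_zero_of_trace (A : Matrix ι ι ℂ) (u w : ι → ℂ) (h : Matrix.trace (A * vecMulVec u w) = 0) :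
    vecMulVec u w * A * vecMulVec u w = 0 := by
  have hdot : (w ᵥ* A) ⬝ᵥ u = 0 := by
    rwa [mul_vecMulVec, trace_vecMulVec, dotProduct_comm, dotProduct_mulVec] at h
  rw [vecMulVec_mul, vecMulVec_mul_vecMulVec, hdot, zero_smul]
  ext i j
  simp [vecMulVec_apply]

end RankOne

/-! ## §5 ★ Rank-one directions have window degree `≤ 1` -/

variable {n m : ℕ}

/-- The pull-back of an affine pencil along `x + s·v` is `N(x) + s·lin_v N`, written with the outer-product form of the linear part. -/
theorem map_lineSubst_eq_of_rankOne (N : AffMat n m) (hN : IsAffine N) (x v : Fin n × Fin n → ℂ) (u w : Fin m → ℂ)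
    (hv : ∀ i j, linEntry N i j v = u i * w j) :
    N.map (lineSubst x v) =
      (N.map (eval x)).map (C : ℂ → MvPolynomial (Fin 1) ℂ) + (X 0 : MvPolynomial (Fin 1) ℂ) • (vecMulVec u w).map C := by
  ext i j
  rw [Matrix.map_apply, lineSubst_apply_of_le_one N hN x v i j, Matrix.add_apply, Matrix.map_apply, Matrix.map_apply,
    Matrix.smul_apply, Matrix.map_apply, vecMulVec_apply, hv i j, smul_eq_mul, mul_comm (X 0)]

/-- ★ **RANK-ONE DIRECTIONS HAVE WINDOW DEGREE ≤ 1.**  For an affine pencil `N` with `N ^ H = 0` and a direction `v` whose linear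
coefficient matrix is an outer product `u wᵀ` (rank `≤ 1`), EVERY power of the pull-back `N(x + s v)` has entries of `s`-degree `≤ 1`:
`(A + sV)^p = A^p + s·Σ_a A^a V A^{p−1−a}` exactly, because `V A^a V = tr(A^a V)·V = 0` on a nilpotent line. [this file] -/
theorem totalDegree_pow_map_lineSubst_le_one_of_rankOne (N : AffMat n m) (hN : IsAffine N) {H : ℕ} (hnil : N ^ H = 0)
    (x v : Fin n × Fin n → ℂ) (u w : Fin m → ℂ) (hv : ∀ i j, linEntry N i j v = u i * w j) (p : ℕ) (i j : Fin m) :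
    ((((N.map (lineSubst x v)) ^ p) i j)).totalDegree ≤ 1 := by
  set A : Matrix (Fin m) (Fin m) ℂ := N.map (eval x) with hA
  set V : Matrix (Fin m) (Fin m) ℂ := vecMulVec u w with hV
  set Cm : Matrix (Fin m) (Fin m) ℂ →+* Matrix (Fin m) (Fin m) (MvPolynomial (Fin 1) ℂ) :=
    (C : ℂ →+* MvPolynomial (Fin 1) ℂ).mapMatrix with hCm
  have hM : N.map (lineSubst x v) = Cm A + (X 0 : MvPolynomial (Fin 1) ℂ) • Cm V := by
    rw [hCm, RingHom.mapMatrix_apply, RingHom.mapMatrix_apply]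
    exact map_lineSubst_eq_of_rankOne N hN x v u w hv
  have hlin : (N.map (lineSubst x v)) ^ H = 0 :=
    pow_lineSubst_eq_zero N (fun y => by rw [← Matrix.map_pow, hnil]; exact Matrix.map_zero _ (map_zero _)) x v
  have hlin' : (A.map (C : ℂ → MvPolynomial (Fin 1) ℂ) + (X 0 : MvPolynomial (Fin 1) ℂ) • V.map C) ^ H = 0 := by
    rw [← map_lineSubst_eq_of_rankOne N hN x v u w hv]; exact hlin
  have htr : ∀ a : ℕ, Matrix.trace (A ^ a * V) = 0 := trace_pow_mul_eq_zero_of_nilpotent_line A V hlin'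
  have hsand : ∀ c : ℕ, ((X 0 : MvPolynomial (Fin 1) ℂ) * X 0) • (Cm V * (Cm A) ^ c * Cm V) = 0 := by
    intro c
    rw [← map_pow, ← map_mul, ← map_mul, hV, sandwich_eq_zero_of_trace (A ^ c) u w (htr c), map_zero, smul_zero]
  rw [hM, pow_add_smul_of_sandwich _ _ _ hsand p]
  have hS : (∑ a ∈ Finset.range p, Cm A ^ a * Cm V * Cm A ^ (p - 1 - a)) =
      Cm (∑ a ∈ Finset.range p, A ^ a * V * A ^ (p - 1 - a)) := by
    rw [map_sum]
    refine Finset.sum_congr rfl fun a _ => ?_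
    rw [map_mul, map_mul, map_pow, map_pow]
  rw [hS, ← map_pow, Matrix.add_apply, Matrix.smul_apply, hCm, RingHom.mapMatrix_apply, RingHom.mapMatrix_apply,
    Matrix.map_apply, Matrix.map_apply, smul_eq_mul]
  refine (totalDegree_add _ _).trans (max_le ?_ ?_)
  · rw [totalDegree_C]; exact Nat.zero_le _
  · refine (totalDegree_mul _ _).trans ?_
    rw [totalDegree_X, totalDegree_C]

/-- ★ **LEDGER FORM.**  A direction space ALL of whose members have rank-`≤ 1` linear coefficient matrix is a whole-pencil ledger of
window order `1` (every power `b ≤ n − 1` — indeed every power — has `s`-degree `≤ 1` along it), for every nilpotent affine pencil.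
[this file] -/
theorem ledger_one_of_rankOne (N : AffMat n m) (hN : IsAffine N) {H : ℕ} (hnil : N ^ H = 0)
    (K : Submodule ℂ (Fin n × Fin n → ℂ)) (hK : ∀ v ∈ K, ∃ u w : Fin m → ℂ, ∀ i j, linEntry N i j v = u i * w j) :
    Ledger n m N (fun _ => True) K 1 := by
  intro x v hv b _ i j _ _
  obtain ⟨u, w, huw⟩ := hK v hv
  exact totalDegree_pow_map_lineSubst_le_one_of_rankOne N hN hnil x v u w huw b i j

/-- `linEntry` is linear in the direction: scalar multiples. -/
theorem linEntry_smul (N : AffMat n m) (i j : Fin m) (t : ℂ) (v : Fin n × Fin n → ℂ) :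
    linEntry N i j (t • v) = t * linEntry N i j v := by
  unfold linEntry
  rw [Finset.mul_sum]
  refine Finset.sum_congr rfl fun c _ => ?_
  rw [Pi.smul_apply, smul_eq_mul, mul_assoc]

/-- `linEntry` along a coordinate direction `δ_e` is the coefficient of `x_e`. -/
theorem linEntry_single (N : AffMat n m) (i j : Fin m) (e : Fin n × Fin n) :
    linEntry N i j (Pi.single e (1 : ℂ)) = coeff (Finsupp.single e 1) (N i j) := by
  classical
  unfold linEntry
  rw [Finset.sum_eq_single e]
  · rw [Pi.single_eq_same, one_mul]
  · intro c _ hc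
    rw [Pi.single_eq_of_ne hc, zero_mul]
  · intro h; exact absurd (Finset.mem_univ e) h

/-- ★ **COORDINATE FORM.**  If the coefficient matrix `[x_e] N` of a coordinate `e` is an outer product (rank `≤ 1`), the coordinate line
`ℂ·δ_e` is a whole-pencil ledger of window order `1`; in the currency of ✓ `InitialForm.LedgerTorus.not_relCert_of_count`, `δ_e` lies in the
window cone of every order `k ≥ 1`, so the per-coordinate census never counts a rank-one coordinate beyond order `0`. [this file] -/
theorem ledger_one_span_single (N : AffMat n m) (hN : IsAffine N) {H : ℕ} (hnil : N ^ H = 0) (e : Fin n × Fin n)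
    (u w : Fin m → ℂ) (he : ∀ i j, coeff (Finsupp.single e 1) (N i j) = u i * w j) :
    Ledger n m N (fun _ => True) (ℂ ∙ (Pi.single e (1 : ℂ) : Fin n × Fin n → ℂ)) 1 := by
  refine ledger_one_of_rankOne N hN hnil _ fun v hv => ?_
  obtain ⟨t, rfl⟩ := Submodule.mem_span_singleton.mp hv
  refine ⟨fun i => t * u i, w, fun i j => ?_⟩
  rw [linEntry_smul, linEntry_single, he i j, mul_assoc]

/-- ★ **ROW FORM.**  The directions that move only ONE ROW `r` of the pencil form a whole-pencil ledger of window order `1`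
(their linear coefficient matrices are `e_r ⊗ (row)`). [this file] -/
theorem ledger_one_of_row (N : AffMat n m) (hN : IsAffine N) {H : ℕ} (hnil : N ^ H = 0) (r : Fin m)
    (K : Submodule ℂ (Fin n × Fin n → ℂ)) (hK : ∀ v ∈ K, ∀ i j, i ≠ r → linEntry N i j v = 0) :
    Ledger n m N (fun _ => True) K 1 := by
  classical
  refine ledger_one_of_rankOne N hN hnil K fun v hv => ⟨Pi.single r 1, fun j => linEntry N r j v, fun i j => ?_⟩
  by_cases hi : i = r
  · subst hi; rw [Pi.single_eq_same, one_mul]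
  · rw [hK v hv i j hi, Pi.single_eq_of_ne hi, zero_mul]

/-- ★ **COLUMN FORM.**  The directions that move only ONE COLUMN `c` of the pencil form a whole-pencil ledger of window order `1`.
[this file] -/
theorem ledger_one_of_col (N : AffMat n m) (hN : IsAffine N) {H : ℕ} (hnil : N ^ H = 0) (c : Fin m)
    (K : Submodule ℂ (Fin n × Fin n → ℂ)) (hK : ∀ v ∈ K, ∀ i j, j ≠ c → linEntry N i j v = 0) :
    Ledger n m N (fun _ => True) K 1 := by
  classical
  refine ledger_one_of_rankOne N hN hnil K fun v hv => ⟨fun i => linEntry N i c v, Pi.single c 1, fun i j => ?_⟩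
  by_cases hj : j = c
  · subst hj; rw [Pi.single_eq_same, mul_one]
  · rw [hK v hv i j hj, Pi.single_eq_of_ne hj, mul_zero]

end Summit.ValiantsHypothesis.ValiantsHypothesis.Theorems.GrenetZeon.LongMassRankOne

end
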